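import Summits.QuantumFields.BalabanUV.Beta.NVertexSectorsPeriodised
import Summits.QuantumFields.BalabanUV.Beta.FP.TorusHSideJetPeriodic

/-!
# `BalabanUV.Beta.FP.TorusLamJunctionShape` — road «FP» for binder row D1, ROUTE T (β1), SPEC-48 §E (E4b), THE SHAPE:
# **THE Λ JUNCTION OF `hHN₁` IS ONE LATTICE-KERNEL IDENTITY AFTER ONE DIAGONAL PERIODISATION** — the wrapper's Λ terms are `perF T (dper T (Σ_{j ≤ n+1} 𝒦_j))`
# (g36∕g37), the row's Λ sector is `perF T (dper T (cΛ·Σ_b colN b·S^Λ_b|ff))` (an2 g61 PART 11 + `perF_dper_core_of_biLoc`), so (J-Λ) ⟸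
# `dper T (Σ_{j ≤ n+1} 𝒦_j) = dper T (cΛ·Σ_b colN b·S^Λ_b|ff)`; with R-FP-77 the whole N-binding then rests on (J0) + (J-W) termwise + this ONE identity

WHY.  `TorusNBindingOfJunctions.hHN1_shape_of_junctions` (g38, p468813 ✓) reduces the wrapper's `hHN₁` at `v := dv n B (μ, y)` to (J0) a constant tree-gauge read-out,
(J-W) the termwise W junction, and (J-Λ) ONE MATRIX identity on the finest torus `T := towerTorus Lc (fine Lc M) (n+1)`:
`w (n+1) • Σ_ā hb (n+1) ā • Λ_ā|ff + compSumSym … = cΛ (n+2) • Σ_b colN b • (perF T (dper T (S^Λ_b)))|ff`, `S^Λ := SLam N (lamCoeffOf (KInv N) N) (compH R.r Lc (n+2))`,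
`N = Lc^(n+2)`, `colN b = (perF T (AN R (n+1))) ((b.1, inl b.2), (wrapPt T (N•y), inr μ))`.  Both sides are periodisations of DISPLAYED lattice kernels: the left by
g36's `TorusCompanionLamPacked.compSumSym_lam_eq_perF_dper` + g37's `storey_top_eq_core` (§1, the Λ half of g37's `H1f_eq_perF_dper` on its own:
`= perF T (dper T (Σ_{j ∈ range (n+2)} 𝒦_j))`), the right by the road's `TorusCompanionCorePeriodic.perF_dper_core_of_biLoc` with an2's PART 11 letter
`NVertexSectorsPeriodised.locStencil_lamSector` (§2: `= perF T (dper T ΛN)`, `ΛN x z a b := cΛ·Σ_b colN b·S^Λ_b x z (inl a) (inl b)`, letters exported).  Hence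
(§3 **`lamJunction_of_dper_eq`**) (J-Λ) FOLLOWS from the lattice identity `dper T (Σ_{j ∈ range (n+2)} 𝒦_j) = dper T ΛN`, and the `hHN₁`-shaped equation follows
from (J0) + (J-W) termwise + that identity as `TorusNBindingOfJunctions.hHN1_shape_of_junctions … (lamJunction_of_dper_eq …)` (one application; not restated here) — the currency in which an2's F6a′ `compVHKer_unroll` ∕ F6a″ `liftUp_eq_sum_compLinKer` ∕
F6a‴ `tsum_mul_compVHKer_eq` ∕ PART 8 `mul_sum_mul_SLam_eq` and the storey-weight words `w k·hb k ā = cΛ·Σ_m λ′_k (ā + T_k∘m)` speak (the identity itself is NOT here).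

WHAT ([folklore] bookkeeping BY NAME; no `def`, no `def … : Prop`, nothing cited, 0 sorry): §1 (generic `d`, g37's data) **`lamTerms_eq_perF_dper`**; §2 (an2's record objects,
any box `T`) `lamSectorN_biLoc`, **`lamSectorN_eq_perF_dper`**, `summable_lamSectorN_diag ∕ _right`; §3 (the wrapper's finest torus) **`lamJunction_of_dper_eq`**.  WRAPPER DICTIONARY as in `TorusNBindingOfJunctions` (`M := Mc B`, `hb k := hb n B k v`, `l := lv n B v`, `v := dv n B (μ,y)`,
`H₀ := H₀ n B`, `c := c n`, `w := w n`, `cf k := cf n B k`, `𝒽 μ y := symHessFFAt (toSite (ctrOff 4 Lc)) Lc μ y`, `N₁ := N`, `lev i := n+1−i`, `rs _ := ctrOff 4 Lc`,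
`R := Roots.ctr Lc`, `P := Pn`; ONE brick list `ℓ` below the depth as in g36∕g37).
WHAT THIS IS NOT: not the lattice identity `dper T (Σ 𝒦_j) = dper T ΛN` (E4b proper — the storey unrolling, row and road by name), not (J-W), not R-FP-77's choice itself;
no row of the END wrapper discharged; no estimate; nothing of Bałaban's asserted, valued or discharged; 0∕4 row-D1 binders (hW, hR, D1Tel, D1Rep); ROOT M‴ p325680
untouched; NOT (C1), NOT (L2′), NOT (T-ID), NOT SDF, NOT D1, NOT BetaPertH, NOT continuum, NOT Clay.

HONEST DEPENDENCY (page 1, mandatory): continuum YM on T⁴ ⇐ BetaPertH ∧ nine spine estimates (0/9 proved); BetaPertH ⇐ (D1) ∧ (D4) ∧ CAP+tail;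
G-an2-4 gates asym, D1 and NE2/3/4.  HONEST FRAMING (cell contract, verbatim): «discharging `BetaPertH` makes Bałaban's UV stability UNCONDITIONAL —
a real constructive-QFT result; it is NOT the continuum limit and NOT the Clay problem.»  ABSOLUTE RULE (cell charter, verbatim): «No internally-minted
statement may enter as a cited fact. Every hypothesis is either kernel-proved in this package or a verbatim quotation of a PUBLISHED theorem with page
reference. The manuscript(s) under audit are NOT citable for their own disputed steps — they are the thing under adjudication; programme-internal
(2001/route/tribunal) claims are never citable.»  Road «FP» OWNER, b2b-balaban-beta-d1-p3 gen 38, 2026-08-26.  No existing file touched.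
-/

noncomputable section

open scoped BigOperators

namespace Summit.QuantumFields.BalabanUV.Beta.FP.TorusLamJunctionShape

open Finset Matrix
open Literature.MathematicalPhysics.QuantumFieldTheory.Balaban1983to89 Literature.MathematicalPhysics.QuantumFieldTheory.Balaban1983to89.Beta
open B4TorusKernel.MultiPeriod (translate)  open B5Prop11Plancherel (fine)  open B6Lemma24Torus (pbox)
open AffineAveraging (Site)  open AveragingHessianKernels (Bond)  open AveragingContoursRooted (ctr)
open ExpKernelCalculus (MKer BiLoc)  open OneStepResolventKernel (Fib KInv LocStencil)  open InterLevelTransport (SLam)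
open BalabanStepJets (lamCoeffOf)  open StepJetData (wilsonA)
open Summit.QuantumFields.BalabanUV.Beta.SymAveragingHessianCounts (symLinKerAt)  open Summit.QuantumFields.BalabanUV.Beta.BorderedHessian (stepScale)
open Summit.QuantumFields.BalabanUV.Beta.CompositeVertexKernelRec (compLinKer)
open Summit.QuantumFields.BalabanUV.Beta.CompositeOneShotJets (compH)
open Summit.QuantumFields.BalabanUV.Beta.CompositeOneShotJetData (Roots Pins AN VN)
open Summit.QuantumFields.BalabanUV.Beta.NVertexSectorsPeriodised (locStencil_lamSector)
open Summit.QuantumFields.BalabanUV.Beta.FP.KernelPeriodisationFib (Idx perF)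
open Summit.QuantumFields.BalabanUV.Beta.FP.KernelPeriodisationFibLoc (dper)
open Summit.QuantumFields.BalabanUV.Beta.FP.TorusGaugeCovariancePairing (wrapPt)
open Summit.QuantumFields.BalabanUV.Beta.FP.TorusCompositeObjects (towerTorus)
open Summit.QuantumFields.BalabanUV.Beta.FP.TorusCompositeCompanionSumG (compSumSym)  open Summit.QuantumFields.BalabanUV.Beta.FP.TorusCompositeCompanionFamilyG (onTowerFamily)
open Summit.QuantumFields.BalabanUV.Beta.FP.TorusCompanionSumPeriodic (perF_dper_finset_sum)
open Summit.QuantumFields.BalabanUV.Beta.FP.TorusCompanionCorePeriodic (perF_dper_core_of_biLoc summable_core_diag summable_core_right summable_ff_diag_of_biLoc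
  summable_ff_right_of_biLoc)
open Summit.QuantumFields.BalabanUV.Beta.FP.TorusCompanionLamPacked (compSumSym_lam_eq_perF_dper)
open Summit.QuantumFields.BalabanUV.Beta.FP.TorusHSideJetPeriodic (storey_top_eq_core summable_storey_diag summable_storey_right)

variable {d : ℕ}

/-! ## §1 The wrapper's Λ terms alone are one periodised lattice kernel (the Λ half of g37's `H1f_eq_perF_dper`) -/

section LamTerms

variable (Lc : ℕ) [NeZero Lc] (N n : ℕ) (M : Fin (d + 1) → ℕ) [∀ μ, NeZero (M μ)] (lev : ℕ → ℕ)
  (ℓ : ℕ → Fin (d + 1) → Site (d + 1) → Bond (d + 1) → ℝ)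
  (𝒽 : Fin (d + 1) → Site (d + 1) → MKer (d + 1) (Fib d))
  (cf : ℕ → Fin (d + 1) → Site (d + 1) → Fin (d + 1) → Site (d + 1) → ℝ) (w : ℕ → ℝ)
  (hb : (k : ℕ) → (↥(pbox (towerTorus Lc M k)) × Fin (d + 1) → ℝ))
  {Cs : ℕ → ℝ} {δ : ℝ} (hLS : ∀ j, LocStencil (SLam N (cf j) 𝒽) (Cs j) δ) (hCs : ∀ j, 0 ≤ Cs j) (hδ : 0 < δ)
  (hℓ : ∀ i < n, ∀ (μ : Fin (d + 1)) (y : Site (d + 1)) (g : Bond (d + 1)),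
    ℓ i μ y g = stepScale d Lc (lev (n - i)) * ((Lc : ℝ) ^ (d + 1) * symLinKerAt (ctr (d + 1) Lc) Lc μ y g))
  {𝒦 : ℕ → MKer (d + 1) (Fin (d + 1))}
  (h𝒦 : ∀ j ≤ n, ∀ (β β' : Site (d + 1)) (b b' : Fin (d + 1)), 𝒦 j β β' b b'
    = ∑ a : Fin (d + 1), ∑ a' : Fin (d + 1), ∑' γ : Site (d + 1), ∑' γ' : Site (d + 1),
        compLinKer ℓ Lc (n - j) (b, β) (a, γ)
          * (w j * ∑ ā : ↥(pbox (towerTorus Lc M j)) × Fin (d + 1),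
              hb j ā * SLam N (cf j) 𝒽 ā.2 (ā.1 : Site (d + 1)) γ γ' (Sum.inl a) (Sum.inl a'))
          * compLinKer ℓ Lc (n - j) (b', β') (a', γ'))
include hLS hCs hδ hℓ h𝒦

/-- [folklore] **`lamTerms_eq_perF_dper` — THE WRAPPER's Λ TERMS (top storey + companion sum) ARE `perF T (dper T (Σ_{j ∈ range (n+1)} 𝒦_j))`**, `T := towerTorus Lc M n`
(g36's `compSumSym_lam_eq_perF_dper` for the storeys below, g37's `storey_top_eq_core` + `perF_dper_core_of_biLoc` for the top, `perF_dper_finset_sum` to add). -/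
theorem lamTerms_eq_perF_dper (hLc : 2 ≤ Lc) (rs : ℕ → (Fin (d + 1) → ℕ)) :
    w n • ∑ ā : ↥(pbox (towerTorus Lc M n)) × Fin (d + 1), hb n ā •
        (perF (towerTorus Lc M n) (dper (towerTorus Lc M n) (SLam N (cf n) 𝒽 ā.2 (ā.1 : Site (d + 1))))).submatrix
          (fun p : ↥(pbox (towerTorus Lc M n)) × Fin (d + 1) => ((p.1, Sum.inl p.2) : Idx (towerTorus Lc M n) (Fib d)))
          (fun p : ↥(pbox (towerTorus Lc M n)) × Fin (d + 1) => ((p.1, Sum.inl p.2) : Idx (towerTorus Lc M n) (Fib d)))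
      + compSumSym Lc (onTowerFamily Lc M (fun k => w k • ∑ ā : ↥(pbox (towerTorus Lc M k)) × Fin (d + 1), hb k ā •
        (perF (towerTorus Lc M k) (dper (towerTorus Lc M k) (SLam N (cf k) 𝒽 ā.2 (ā.1 : Site (d + 1))))).submatrix
          (fun p : ↥(pbox (towerTorus Lc M k)) × Fin (d + 1) => ((p.1, Sum.inl p.2) : Idx (towerTorus Lc M k) (Fib d)))
          (fun p : ↥(pbox (towerTorus Lc M k)) × Fin (d + 1) => ((p.1, Sum.inl p.2) : Idx (towerTorus Lc M k) (Fib d))))) M lev rs n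
      = perF (towerTorus Lc M n) (dper (towerTorus Lc M n) (∑ j ∈ Finset.range (n + 1), 𝒦 j)) := by
  have htop : w n • ∑ ā : ↥(pbox (towerTorus Lc M n)) × Fin (d + 1), hb n ā •
      (perF (towerTorus Lc M n) (dper (towerTorus Lc M n) (SLam N (cf n) 𝒽 ā.2 (ā.1 : Site (d + 1))))).submatrix
        (fun p : ↥(pbox (towerTorus Lc M n)) × Fin (d + 1) => ((p.1, Sum.inl p.2) : Idx (towerTorus Lc M n) (Fib d)))
        (fun p : ↥(pbox (towerTorus Lc M n)) × Fin (d + 1) => ((p.1, Sum.inl p.2) : Idx (towerTorus Lc M n) (Fib d)))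
      = perF (towerTorus Lc M n) (dper (towerTorus Lc M n) (𝒦 n)) := by
    rw [storey_top_eq_core Lc N n M ℓ 𝒽 cf w hb h𝒦]
    exact (perF_dper_core_of_biLoc (towerTorus Lc M n) (fun ā : ↥(pbox (towerTorus Lc M n)) × Fin (d + 1) => SLam N (cf n) 𝒽 ā.2 (ā.1 : Site (d + 1)))
      (p := fun ā => (ā.1 : Site (d + 1))) (q := fun ā => (ā.1 : Site (d + 1))) (C := fun _ => Cs n) (δ := δ) (w n) (hb n) (fun ā => hLS n ā.2 (ā.1 : Site (d + 1))) (fun _ => hCs n) hδ).symm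
  have hsum : perF (towerTorus Lc M n) (dper (towerTorus Lc M n) (∑ j ∈ Finset.range (n + 1), 𝒦 j))
      = perF (towerTorus Lc M n) (dper (towerTorus Lc M n) (∑ j ∈ Finset.range n, 𝒦 j)) + perF (towerTorus Lc M n) (dper (towerTorus Lc M n) (𝒦 n)) := by
    rw [perF_dper_finset_sum (towerTorus Lc M n) (Finset.range (n + 1)) 𝒦
        (fun j hj => summable_storey_diag Lc N n M lev ℓ 𝒽 cf w hb hLS hCs hδ hℓ h𝒦 j (Nat.lt_succ_iff.mp (Finset.mem_range.mp hj)))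
        (fun j hj => summable_storey_right Lc N n M lev ℓ 𝒽 cf w hb hLS hCs hδ hℓ h𝒦 j (Nat.lt_succ_iff.mp (Finset.mem_range.mp hj))),
      perF_dper_finset_sum (towerTorus Lc M n) (Finset.range n) 𝒦
        (fun j hj => summable_storey_diag Lc N n M lev ℓ 𝒽 cf w hb hLS hCs hδ hℓ h𝒦 j (Finset.mem_range.mp hj).le)
        (fun j hj => summable_storey_right Lc N n M lev ℓ 𝒽 cf w hb hLS hCs hδ hℓ h𝒦 j (Finset.mem_range.mp hj).le),
      Finset.sum_range_succ]
  rw [htop, compSumSym_lam_eq_perF_dper Lc hLc N n M lev rs ℓ hℓ 𝒽 cf w hb hLS hCs hδ h𝒦, hsum]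
  exact add_comm _ _

end LamTerms

/-! ## §2 The row's Λ sector is the periodisation of one displayed lattice core -/

section LamSector

variable {Lc : ℕ} [NeZero Lc] (R : Roots Lc) (j : ℕ) (T : Fin (3 + 1) → ℕ) [∀ μ, NeZero (T μ)]

omit [∀ μ, NeZero (T μ)] in
/-- [folklore] the Λ-sector tables `S^Λ_b := SLam N (lamCoeffOf (KInv N) N) (compH R.r Lc (j+1)) b.2 b.1`, `N = Lc^(j+1)`, indexed by the torus bonds, are bi-localised at their
bond with ONE nonnegative constant and ONE positive rate (an2 g61's `locStencil_lamSector`). -/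
theorem lamSectorN_biLoc : ∃ Cs δs : ℝ, 0 ≤ Cs ∧ 0 < δs ∧ ∀ b : ↥(pbox T) × Fin (3 + 1),
    BiLoc (SLam (Lc ^ (j + 1)) (lamCoeffOf (KInv (N := Lc ^ (j + 1)) (d := 3)) (Lc ^ (j + 1))) (compH R.r Lc (j + 1)) b.2 (b.1 : Site (3 + 1)))
      (b.1 : Site (3 + 1)) (b.1 : Site (3 + 1)) Cs δs := by
  obtain ⟨Cs, δs, hδs, h⟩ := locStencil_lamSector R j
  exact ⟨Cs, δs, (h 0 0).nonneg (Sum.inl 0), hδs, fun b => h b.2 (b.1 : Site (3 + 1))⟩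

/-- [folklore] **`lamSectorN_eq_perF_dper` — THE ROW's PERIODISED Λ SECTOR IS `perF T (dper T ΛN)` FOR ONE DISPLAYED LATTICE CORE**
`ΛN x z a b := cΛ·Σ_b colN b·S^Λ_b x z (inl a) (inl b)` (any weights `colN`, any box `T`): `cΛ • Σ_b colN b • (perF T (dper T (S^Λ_b)))|ff = perF T (dper T ΛN)`
(`TorusCompanionCorePeriodic.perF_dper_core_of_biLoc` with `lamSectorN_biLoc`). -/
theorem lamSectorN_eq_perF_dper (cΛ : ℝ) (colN : ↥(pbox T) × Fin (3 + 1) → ℝ) :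
    cΛ • ∑ b : ↥(pbox T) × Fin (3 + 1), colN b •
        (perF T (dper T (SLam (Lc ^ (j + 1)) (lamCoeffOf (KInv (N := Lc ^ (j + 1)) (d := 3)) (Lc ^ (j + 1))) (compH R.r Lc (j + 1)) b.2
          (b.1 : Site (3 + 1))))).submatrix
          (fun p : ↥(pbox T) × Fin (3 + 1) => ((p.1, Sum.inl p.2) : Idx T (Fib 3))) (fun p : ↥(pbox T) × Fin (3 + 1) => ((p.1, Sum.inl p.2) : Idx T (Fib 3)))
      = perF T (dper T (fun x z (a b : Fin (3 + 1)) => cΛ * ∑ b₀ : ↥(pbox T) × Fin (3 + 1), colN b₀ *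
          SLam (Lc ^ (j + 1)) (lamCoeffOf (KInv (N := Lc ^ (j + 1)) (d := 3)) (Lc ^ (j + 1))) (compH R.r Lc (j + 1)) b₀.2 (b₀.1 : Site (3 + 1)) x z
            (Sum.inl a) (Sum.inl b))) := by
  obtain ⟨Cs, δs, hCs, hδs, h⟩ := lamSectorN_biLoc R j T
  exact (perF_dper_core_of_biLoc T (fun b : ↥(pbox T) × Fin (3 + 1) =>
      SLam (Lc ^ (j + 1)) (lamCoeffOf (KInv (N := Lc ^ (j + 1)) (d := 3)) (Lc ^ (j + 1))) (compH R.r Lc (j + 1)) b.2 (b.1 : Site (3 + 1)))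
    (p := fun b => (b.1 : Site (3 + 1))) (q := fun b => (b.1 : Site (3 + 1))) (C := fun _ => Cs) (δ := δs) cΛ colN h (fun _ => hCs) hδs).symm

/-- [folklore] the diagonal letter of the row's Λ core `ΛN` on the box `T`. -/
theorem summable_lamSectorN_diag (cΛ : ℝ) (colN : ↥(pbox T) × Fin (3 + 1) → ℝ) (x z : Site (3 + 1)) (a b : Fin (3 + 1)) :
    Summable fun m₀ : Site (3 + 1) => (fun x z (a b : Fin (3 + 1)) => cΛ * ∑ b₀ : ↥(pbox T) × Fin (3 + 1), colN b₀ *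
        SLam (Lc ^ (j + 1)) (lamCoeffOf (KInv (N := Lc ^ (j + 1)) (d := 3)) (Lc ^ (j + 1))) (compH R.r Lc (j + 1)) b₀.2 (b₀.1 : Site (3 + 1)) x z
          (Sum.inl a) (Sum.inl b)) (translate T x m₀) (translate T z m₀) a b := by
  obtain ⟨Cs, δs, hCs, hδs, h⟩ := lamSectorN_biLoc R j T
  exact summable_core_diag T cΛ colN _ (summable_ff_diag_of_biLoc T _ (p := fun b => (b.1 : Site (3 + 1))) (q := fun b => (b.1 : Site (3 + 1)))
    (C := fun _ => Cs) (δ := δs) h (fun _ => hCs) hδs) x z a b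

/-- [folklore] the second-argument letter of the row's Λ core `ΛN` on the box `T`. -/
theorem summable_lamSectorN_right (cΛ : ℝ) (colN : ↥(pbox T) × Fin (3 + 1) → ℝ) (x z : Site (3 + 1)) (a b : Fin (3 + 1)) :
    Summable fun m : Site (3 + 1) => dper T (fun x z (a b : Fin (3 + 1)) => cΛ * ∑ b₀ : ↥(pbox T) × Fin (3 + 1), colN b₀ *
        SLam (Lc ^ (j + 1)) (lamCoeffOf (KInv (N := Lc ^ (j + 1)) (d := 3)) (Lc ^ (j + 1))) (compH R.r Lc (j + 1)) b₀.2 (b₀.1 : Site (3 + 1)) x z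
          (Sum.inl a) (Sum.inl b)) x (translate T z m) a b := by
  obtain ⟨Cs, δs, hCs, hδs, h⟩ := lamSectorN_biLoc R j T
  exact summable_core_right T cΛ colN _
    (summable_ff_diag_of_biLoc T _ (p := fun b => (b.1 : Site (3 + 1))) (q := fun b => (b.1 : Site (3 + 1))) (C := fun _ => Cs) (δ := δs) h (fun _ => hCs) hδs)
    (summable_ff_right_of_biLoc T _ (p := fun b => (b.1 : Site (3 + 1))) (q := fun b => (b.1 : Site (3 + 1))) (C := fun _ => Cs) (δ := δs) h (fun _ => hCs) hδs)
    x z a b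

end LamSector

/-! ## §3 (J-Λ) from ONE lattice identity (the N-binding then follows by `TorusNBindingOfJunctions.hHN1_shape_of_junctions`) -/

section Wrapper

variable {Lc : ℕ} [NeZero Lc] (R : Roots Lc) (P : Pins) (N₁ n : ℕ) (M : Fin (3 + 1) → ℕ) [∀ μ, NeZero (M μ)] (lev : ℕ → ℕ) (rs : ℕ → (Fin (3 + 1) → ℕ))
  (ℓ : ℕ → Fin (3 + 1) → Site (3 + 1) → Bond (3 + 1) → ℝ)
  (𝒽 : Fin (3 + 1) → Site (3 + 1) → MKer (3 + 1) (Fib 3))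
  (cf : ℕ → Fin (3 + 1) → Site (3 + 1) → Fin (3 + 1) → Site (3 + 1) → ℝ) (w : ℕ → ℝ)
  (hb : (k : ℕ) → (↥(pbox (towerTorus Lc (fine Lc M) k)) × Fin (3 + 1) → ℝ))
  {Cs : ℕ → ℝ} {δ : ℝ} (hLS : ∀ j, LocStencil (SLam N₁ (cf j) 𝒽) (Cs j) δ) (hCs : ∀ j, 0 ≤ Cs j) (hδ : 0 < δ)
  (hℓ : ∀ i < n + 1, ∀ (μ : Fin (3 + 1)) (y : Site (3 + 1)) (g : Bond (3 + 1)),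
    ℓ i μ y g = stepScale 3 Lc (lev (n + 1 - i)) * ((Lc : ℝ) ^ (3 + 1) * symLinKerAt (ctr (3 + 1) Lc) Lc μ y g))
  {𝒦 : ℕ → MKer (3 + 1) (Fin (3 + 1))}
  (h𝒦 : ∀ j ≤ n + 1, ∀ (β β' : Site (3 + 1)) (b b' : Fin (3 + 1)), 𝒦 j β β' b b'
    = ∑ a : Fin (3 + 1), ∑ a' : Fin (3 + 1), ∑' γ : Site (3 + 1), ∑' γ' : Site (3 + 1),
        compLinKer ℓ Lc (n + 1 - j) (b, β) (a, γ)
          * (w j * ∑ ā : ↥(pbox (towerTorus Lc (fine Lc M) j)) × Fin (3 + 1),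
              hb j ā * SLam N₁ (cf j) 𝒽 ā.2 (ā.1 : Site (3 + 1)) γ γ' (Sum.inl a) (Sum.inl a'))
          * compLinKer ℓ Lc (n + 1 - j) (b', β') (a', γ'))
  (μ : Fin (3 + 1)) (y : Site (3 + 1)) (hLc : 2 ≤ Lc)
  -- THE ONE LATTICE IDENTITY ((E4b) proper): the wrapper's storey kernels, summed, and the row's Λ core have the same diagonal periodisation
  (hΛN : dper (towerTorus Lc (fine Lc M) (n + 1)) (∑ j ∈ Finset.range (n + 1 + 1), 𝒦 j)
    = dper (towerTorus Lc (fine Lc M) (n + 1)) (fun x z (a b : Fin (3 + 1)) => P.cΛ (n + 1 + 1) *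
        ∑ b₀ : ↥(pbox (towerTorus Lc (fine Lc M) (n + 1))) × Fin (3 + 1),
          perF (towerTorus Lc (fine Lc M) (n + 1)) (AN R (n + 1)) (b₀.1, Sum.inl b₀.2)
              (wrapPt (towerTorus Lc (fine Lc M) (n + 1)) (((Lc ^ (n + 1 + 1) : ℕ) : ℤ) • y), Sum.inr μ) *
            SLam (Lc ^ (n + 1 + 1)) (lamCoeffOf (KInv (N := Lc ^ (n + 1 + 1)) (d := 3)) (Lc ^ (n + 1 + 1))) (compH R.r Lc (n + 1 + 1)) b₀.2
              (b₀.1 : Site (3 + 1)) x z (Sum.inl a) (Sum.inl b)))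
include hLS hCs hδ hℓ h𝒦 hLc hΛN

/-- [folklore] **`lamJunction_of_dper_eq` — (J-Λ) FROM THE LATTICE IDENTITY**: the Λ junction of `TorusNBindingOfJunctions.hHN1_shape_of_junctions`
(`w (n+1) • Σ_ā hb (n+1) ā • Λ_ā|ff + compSumSym … = cΛ (n+2) • Σ_b colN b • (perF T (dper T (S^Λ_b)))|ff`, `T := towerTorus Lc (fine Lc M) (n+1)`) HOLDS as soon as
`dper T (Σ_{j ∈ range (n+2)} 𝒦_j) = dper T ΛN` (`hΛN`). -/
theorem lamJunction_of_dper_eq :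
    w (n + 1) • ∑ ā : ↥(pbox (towerTorus Lc (fine Lc M) (n + 1))) × Fin (3 + 1), hb (n + 1) ā •
        (perF (towerTorus Lc (fine Lc M) (n + 1)) (dper (towerTorus Lc (fine Lc M) (n + 1)) (SLam N₁ (cf (n + 1)) 𝒽 ā.2 (ā.1 : Site (3 + 1))))).submatrix
          (fun p : ↥(pbox (towerTorus Lc (fine Lc M) (n + 1))) × Fin (3 + 1) => ((p.1, Sum.inl p.2) : Idx (towerTorus Lc (fine Lc M) (n + 1)) (Fib 3)))
          (fun p : ↥(pbox (towerTorus Lc (fine Lc M) (n + 1))) × Fin (3 + 1) => ((p.1, Sum.inl p.2) : Idx (towerTorus Lc (fine Lc M) (n + 1)) (Fib 3)))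
      + compSumSym Lc (onTowerFamily Lc (fine Lc M) (fun k => w k • ∑ ā : ↥(pbox (towerTorus Lc (fine Lc M) k)) × Fin (3 + 1), hb k ā •
        (perF (towerTorus Lc (fine Lc M) k) (dper (towerTorus Lc (fine Lc M) k) (SLam N₁ (cf k) 𝒽 ā.2 (ā.1 : Site (3 + 1))))).submatrix
          (fun p : ↥(pbox (towerTorus Lc (fine Lc M) k)) × Fin (3 + 1) => ((p.1, Sum.inl p.2) : Idx (towerTorus Lc (fine Lc M) k) (Fib 3)))
          (fun p : ↥(pbox (towerTorus Lc (fine Lc M) k)) × Fin (3 + 1) => ((p.1, Sum.inl p.2) : Idx (towerTorus Lc (fine Lc M) k) (Fib 3))))) (fine Lc M) lev rs (n + 1)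
    = P.cΛ (n + 1 + 1) • ∑ b : ↥(pbox (towerTorus Lc (fine Lc M) (n + 1))) × Fin (3 + 1),
        perF (towerTorus Lc (fine Lc M) (n + 1)) (AN R (n + 1)) (b.1, Sum.inl b.2)
            (wrapPt (towerTorus Lc (fine Lc M) (n + 1)) (((Lc ^ (n + 1 + 1) : ℕ) : ℤ) • y), Sum.inr μ) •
          (perF (towerTorus Lc (fine Lc M) (n + 1)) (dper (towerTorus Lc (fine Lc M) (n + 1))
            (SLam (Lc ^ (n + 1 + 1)) (lamCoeffOf (KInv (N := Lc ^ (n + 1 + 1)) (d := 3)) (Lc ^ (n + 1 + 1))) (compH R.r Lc (n + 1 + 1)) b.2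
              (b.1 : Site (3 + 1))))).submatrix
            (fun b : ↥(pbox (towerTorus Lc (fine Lc M) (n + 1))) × Fin (3 + 1) => ((b.1, Sum.inl b.2) : Idx (towerTorus Lc (fine Lc M) (n + 1)) (Fib 3)))
            (fun b : ↥(pbox (towerTorus Lc (fine Lc M) (n + 1))) × Fin (3 + 1) => ((b.1, Sum.inl b.2) : Idx (towerTorus Lc (fine Lc M) (n + 1)) (Fib 3))) := by
  rw [lamTerms_eq_perF_dper Lc N₁ (n + 1) (fine Lc M) lev ℓ 𝒽 cf w hb hLS hCs hδ hℓ h𝒦 hLc rs, hΛN]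
  exact (lamSectorN_eq_perF_dper R (n + 1) (towerTorus Lc (fine Lc M) (n + 1)) (P.cΛ (n + 1 + 1)) _).symm

end Wrapper

end Summit.QuantumFields.BalabanUV.Beta.FP.TorusLamJunctionShape

end
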